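import Literature.NumberTheory.Automorphic.CuspidalRepArchIsotypic
import Literature.NumberTheory.Automorphic.ArchGardingWhittaker
import Literature.NumberTheory.Automorphic.AutomorphicGLnWhittakerFunctionalsRank
import Mathlib.MeasureTheory.Measure.Haar.Unique
import Literature.NumberTheory.Automorphic.HarishChandraConvolutionAdelic
import HarnessLib

/-!
# Transfer between a cuspidal automorphic representation of `GL_n(𝔸_K)` and its archimedean
# component: Gårding spaces, `U(𝔤)`, and continuous Whittaker functionals

This file is the analytic interface of the reduction "global uniqueness of Whittaker functionals
from local uniqueness" (Cogdell (2004), §1.2, proof of Cor. 1.4; Bump (1997), proof of Thm. 3.5.2;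
Getz–Hahn (2024), proof of Thm. 11.3.4) between

* the level-`U₀` structure theorem of `CuspidalRepArchIsotypic` (`Π^{U₀} = ⊕_i S_i(E)` for a cuspidal
  automorphic representation `Π ≤ L²_cusp` of `GL_n(𝔸_K)`, `U₀ ≤ GL_n(𝔸_K^∞)` compact open, `τ` on `E`
  the archimedean component, `S_i : τ → Π^{U₀}` Schur-orthonormal bounded `G_∞`-intertwiners), and
* the archimedean Gårding space / `U(𝔤)`-action / continuous `ψ_∞`-Whittaker functionals of
  `ArchGardingWhittaker` and their global counterparts of `AutomorphicGLnWhittakerFunctionals`.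

Main results (all proved; no named fact):

1. `archShadow`, `archShadowConst`, `integral_indicator_smul_comp_toMixed_eq_smul`: the pushforward
   under `g ↦ g_∞` of the adelic Haar measure cut off at an open relatively compact `D ⊆ GL_n(𝔸_K^∞)`
   is `c_D • archHaar` (`c_D > 0` for `D = U₀` a compact open subgroup), by uniqueness of Haar measure
   on `GL_n(K_∞)`; hence `∫ 𝟙_D(g_f) F(g_∞) dg = c_D ∫ F(h) dh`.
2. `coe_smoothedVector_archLevelWeight_eq_smul`: on the level piece, adelic smoothing by
   `β ⊗ 𝟙_{U₀}` is `c_{U₀}` times archimedean smoothing by `β`.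
3. `corestrictW`, `map_corestrictW_archGardingSpace_le`, `wordArchDeriv_corestrictW`: a bounded
   intertwiner `T : τ → Π^{U₀}` carries the Gårding space of `τ` into the Gårding vectors of level
   `U₀` of `Π` and commutes with `U(𝔤)`; `transferFunctional`,
   `isArchContWhittakerFunctional_transferFunctional`: a continuous global `ψ`-Whittaker functional
   `ℓ` on the Gårding space of `Π` restricts along `T` to a continuous `ψ_∞`-Whittaker functional
   `ℓ ∘ T̂` on the Gårding space of `τ` ("`Λ ∘ (π_v ↪ π)` is a Whittaker functional on `V_{π_v}`",
   Cogdell, loc. cit.).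
4. `adjoint_coe_smoothedVector_mem_archGardingSpace`, `eq_sum_apply_of_mem_gardingSubspace`: conversely
   the adjoints `S_i†` carry the Gårding vectors of level `U₀` into the Gårding space of `τ`, so that
   every `v ∈ gardingSubspace Π U₀` is `Σ_i S_i u_i` with `u_i = S_i† v` Gårding vectors of `τ`
   (coset decomposition `η = Σ_q β_q ⊗ 𝟙_{U₀ y_q}` of a test function left invariant under `(1, U₀)`
   over the finitely many right cosets `U₀ y_q` meeting its support — the level-`U₀` form of
   `V_sm = π_∞^{sm} ⊗ π_f^{U₀}`, Borel–Jacquet (1979), §4.6; Garrett (2018), §7.3).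

## References

* J. W. Cogdell, *Lectures on L-functions, converse theorems, and functoriality for GL_n*, in
  Lectures on automorphic L-functions, Fields Inst. Monogr. 20, AMS 2004, §1.2.
* D. Bump, *Automorphic forms and representations*, Cambridge 1997, §3.5 (Thm. 3.5.2 and its proof).
* J. R. Getz, H. Hahn, *An introduction to automorphic representations*, GTM 300, Springer 2024,
  §4.2, §11.3.
* A. Borel, H. Jacquet, *Automorphic forms and automorphic representations*, Proc. Sympos. Pure
  Math. 33 (Corvallis 1979), part 1, §4.6.
-/

noncomputable section

open MeasureTheory Measure NumberField NumberField.mixedEmbedding IsDedekindDomain Set Filter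
open scoped MatrixGroups InnerProductSpace Topology Classical NNReal ContDiff Matrix.Norms.Operator

namespace Literature.NumberTheory.Automorphic

variable {n : ℕ} {K : Type} [Field K] [NumberField K]
  {μ : Measure (AdelicGroupData.gl n K).automorphicQuotient}
  [(AdelicGroupData.gl n K).IsAutomorphicMeasure μ]

attribute [local instance] adelicBorel borelSpace_adelic locallyCompactSpace_adelic
  secondCountableTopology_gl_adelic glInfBorel borelSpace_glInf locallyCompactSpace_glInf
  secondCountableTopology_glInf

set_option synthInstance.maxHeartbeats 200000

-- Mathlib idiom (Mathlib/Algebra/Lie/OfAssociative.lean): the commutator Lie ring on matrices, needed to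
-- mention the Lie algebra `(archGroupGL n K).lie` of `GL_n(K_∞)` in statements
attribute [local instance 100] LieRing.ofAssociativeRing

-- as in `ArchGardingWhittaker`: the scoped `L∞`-operator normed ring structure on matrices (through
-- which `IsArchSmooth` is defined) is only reducibly defeq to the Pi uniformity
set_option backward.isDefEq.respectTransparency false

/-! ### 1. The archimedean pushforward of the adelic Haar measure cut off at a finite set -/

section Pushforward

variable (n K)

/-- **The archimedean shadow of `adelicHaar` on a finite-adelic set `D`**: the measure
`A ↦ adelicHaar {g | g_∞ ∈ A, g_f ∈ D}` on `GL_n(K_∞)` (the pushforward under `g ↦ g_∞` of the adelic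
Haar measure restricted to `{g_f ∈ D}`). [folklore] -/
def archShadow (D : Set (GL (Fin n) (FiniteAdeleRing (𝓞 K) K))) : Measure (GL (Fin n) (mixedSpace K)) :=
  ((adelicHaar n K).restrict {g : (AdelicGroupData.gl n K).Adelic | GLn.sndHom n K g ∈ D}).map
    fun g : (AdelicGroupData.gl n K).Adelic => GLn.toMixed n K g

variable {n K}

/-- `g ↦ g_∞` is continuous on `(gl n K).Adelic`. [folklore] -/
theorem continuous_toMixed' : Continuous fun g : (AdelicGroupData.gl n K).Adelic => GLn.toMixed n K g :=
  GLn.continuous_toMixed n K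

/-- `g ↦ g_∞` is measurable. [folklore] -/
theorem measurable_toMixed' :
    Measurable fun g : (AdelicGroupData.gl n K).Adelic => GLn.toMixed n K g :=
  continuous_toMixed'.measurable

/-- `g ↦ g_f` is continuous on `(gl n K).Adelic`. [folklore] -/
theorem continuous_sndHom' : Continuous fun g : (AdelicGroupData.gl n K).Adelic => GLn.sndHom n K g :=
  GLn.continuous_sndHom

/-- `{g | g_f ∈ D}` is open (hence measurable) for open `D`. [folklore] -/
theorem isOpen_setOf_sndHom_mem {D : Set (GL (Fin n) (FiniteAdeleRing (𝓞 K) K))} (hD : IsOpen D) :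
    IsOpen {g : (AdelicGroupData.gl n K).Adelic | GLn.sndHom n K g ∈ D} :=
  hD.preimage continuous_sndHom'


/-- `archShadow D` on a measurable set: `adelicHaar {g | g_∞ ∈ A, g_f ∈ D}`. [folklore] -/
theorem archShadow_apply {D : Set (GL (Fin n) (FiniteAdeleRing (𝓞 K) K))}
    {A : Set (GL (Fin n) (mixedSpace K))} (hA : MeasurableSet A) :
    archShadow n K D A = adelicHaar n K ({g : (AdelicGroupData.gl n K).Adelic | GLn.toMixed n K g ∈ A} ∩
      {g : (AdelicGroupData.gl n K).Adelic | GLn.sndHom n K g ∈ D}) := by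
  rw [archShadow, Measure.map_apply measurable_toMixed' hA,
    Measure.restrict_apply (measurable_toMixed' hA)]
  rfl

/-- **`archShadow D` is left invariant** under `GL_n(K_∞)`: left multiplication by `(h, 1)` moves
`g_∞` by `h` and fixes `g_f`, and `adelicHaar` is left invariant. [folklore] -/
theorem isMulLeftInvariant_archShadow {D : Set (GL (Fin n) (FiniteAdeleRing (𝓞 K) K))} (hD : IsOpen D) :
    (archShadow n K D).IsMulLeftInvariant := by
  refine ⟨fun h => ?_⟩
  set S : Set (AdelicGroupData.gl n K).Adelic := {g | GLn.sndHom n K g ∈ D} with hS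
  have hSm : MeasurableSet S := (isOpen_setOf_sndHom_mem hD).measurableSet
  set x : (AdelicGroupData.gl n K).Adelic := (GLn.ofInfinite n K h : GL (Fin n) (AdeleRing (𝓞 K) K))
    with hx
  have hmul : Measurable fun g : (AdelicGroupData.gl n K).Adelic => x * g := measurable_const_mul x
  -- `(h · ) ∘ toMixed = toMixed ∘ (x · )`
  have hcomm : (fun a : GL (Fin n) (mixedSpace K) => h * a) ∘
      (fun g : (AdelicGroupData.gl n K).Adelic => GLn.toMixed n K g) =
      (fun g : (AdelicGroupData.gl n K).Adelic => GLn.toMixed n K g) ∘ fun g => x * g := by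
    funext g
    change h * GLn.toMixed n K g = GLn.toMixed n K (x * g)
    have hm : GLn.toMixed n K (x * g) = GLn.toMixed n K (GLn.ofInfinite n K h) * GLn.toMixed n K g :=
      map_mul (GLn.toMixed n K) (GLn.ofInfinite n K h) g
    rw [hm, GLn.toMixed_ofInfinite]
  -- `x · S = S` and `adelicHaar` is left invariant
  have hpre : (fun g : (AdelicGroupData.gl n K).Adelic => x * g) ⁻¹' S = S := by
    ext g
    change GLn.sndHom n K (x * g) ∈ D ↔ GLn.sndHom n K g ∈ D
    have hm : GLn.sndHom n K (x * g) = GLn.sndHom n K (GLn.ofInfinite n K h) * GLn.sndHom n K g :=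
      map_mul (GLn.sndHom n K) (GLn.ofInfinite n K h) g
    rw [hm, GLn.sndHom_ofInfinite, one_mul]
  have hrestr : ((adelicHaar n K).restrict S).map (fun g : (AdelicGroupData.gl n K).Adelic => x * g) =
      (adelicHaar n K).restrict S := by
    have h1 := Measure.restrict_map (μ := adelicHaar n K) hmul hSm
    rw [hpre, map_mul_left_eq_self] at h1
    exact h1.symm
  rw [archShadow, Measure.map_map (measurable_const_mul h) measurable_toMixed', hcomm,
    ← Measure.map_map measurable_toMixed' hmul]
  change Measure.map (fun g : (AdelicGroupData.gl n K).Adelic => GLn.toMixed n K g)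
    (((adelicHaar n K).restrict S).map fun g : (AdelicGroupData.gl n K).Adelic => x * g) = _
  rw [hrestr]

/-- **`archShadow D` is finite on compact sets** when `D` has compact closure:
`{g | g_∞ ∈ C, g_f ∈ D} ⊆ (C, 1) · (1, closure D)` is compact. [folklore] -/
theorem isFiniteMeasureOnCompacts_archShadow {D : Set (GL (Fin n) (FiniteAdeleRing (𝓞 K) K))}
    (hDc : IsCompact (closure D)) : IsFiniteMeasureOnCompacts (archShadow n K D) := by
  refine ⟨fun C hC => ?_⟩
  rw [archShadow_apply hC.measurableSet]
  set K' : Set (AdelicGroupData.gl n K).Adelic :=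
    (fun p : GL (Fin n) (mixedSpace K) × GL (Fin n) (FiniteAdeleRing (𝓞 K) K) =>
      ((GLn.ofInfinite n K p.1 * GLn.ofFinite n K p.2 : GL (Fin n) (AdeleRing (𝓞 K) K)) :
        (AdelicGroupData.gl n K).Adelic)) '' (C ×ˢ closure D) with hK'
  have hK'c : IsCompact K' := by
    refine (hC.prod hDc).image ?_
    exact ((GLn.continuous_ofInfinite n K).comp continuous_fst).mul
      ((GLn.continuous_ofFinite n K).comp continuous_snd)
  refine lt_of_le_of_lt (measure_mono ?_) hK'c.measure_lt_top
  rintro g ⟨hg1, hg2⟩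
  exact ⟨(GLn.toMixed n K g, GLn.sndHom n K g), ⟨hg1, subset_closure hg2⟩,
    GLn.ofInfinite_toMixed_mul_ofFinite_sndHom g⟩

/-- **`archShadow U₀` charges open sets** for `U₀` an open subgroup (it contains `1`): for `A` open
non-empty, `{g | g_∞ ∈ A, g_f ∈ U₀}` is open non-empty in `GL_n(𝔸_K)`. [folklore] -/
theorem isOpenPosMeasure_archShadow (U₀ : Subgroup (GL (Fin n) (FiniteAdeleRing (𝓞 K) K)))
    (hU₀o : IsOpen (U₀ : Set (GL (Fin n) (FiniteAdeleRing (𝓞 K) K)))) :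
    (archShadow n K (U₀ : Set (GL (Fin n) (FiniteAdeleRing (𝓞 K) K)))).IsOpenPosMeasure := by
  refine ⟨fun A hA hAne => ?_⟩
  obtain ⟨a, ha⟩ := hAne
  rw [archShadow_apply hA.measurableSet]
  have hopen : IsOpen ({g : (AdelicGroupData.gl n K).Adelic | GLn.toMixed n K g ∈ A} ∩
      {g : (AdelicGroupData.gl n K).Adelic | GLn.sndHom n K g ∈ (U₀ : Set _)}) :=
    (hA.preimage continuous_toMixed').inter (isOpen_setOf_sndHom_mem hU₀o)
  refine (hopen.measure_pos (adelicHaar n K) ⟨(GLn.ofInfinite n K a : GL (Fin n) (AdeleRing (𝓞 K) K)), ?_, ?_⟩).ne'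
  · change GLn.toMixed n K (GLn.ofInfinite n K a) ∈ A
    rwa [GLn.toMixed_ofInfinite]
  · change GLn.sndHom n K (GLn.ofInfinite n K a) ∈ (U₀ : Set _)
    rw [GLn.sndHom_ofInfinite]
    exact U₀.one_mem

/-- For `U₀` an open subgroup with compact closure... (compact open), `archShadow U₀` is a Haar measure
on `GL_n(K_∞)`. [folklore] -/
theorem isHaarMeasure_archShadow (U₀ : Subgroup (GL (Fin n) (FiniteAdeleRing (𝓞 K) K)))
    (hU₀o : IsOpen (U₀ : Set (GL (Fin n) (FiniteAdeleRing (𝓞 K) K))))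
    (hU₀c : IsCompact (U₀ : Set (GL (Fin n) (FiniteAdeleRing (𝓞 K) K)))) :
    (archShadow n K (U₀ : Set (GL (Fin n) (FiniteAdeleRing (𝓞 K) K)))).IsHaarMeasure := by
  haveI := isMulLeftInvariant_archShadow (n := n) (K := K) hU₀o
  haveI := isFiniteMeasureOnCompacts_archShadow (n := n) (K := K)
    (by rw [(U₀.isClosed_of_isOpen hU₀o).closure_eq]; exact hU₀c)
  haveI := isOpenPosMeasure_archShadow U₀ hU₀o
  exact {}

/-- **The archimedean shadow constant** `c_D ≥ 0` of a finite-adelic open set `D` of compact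
closure: `archShadow D = c_D · archHaar` on continuous compactly supported functions
(uniqueness of left invariant measures, Mathlib's `haarScalarFactor`). [folklore] -/
def archShadowConst {D : Set (GL (Fin n) (FiniteAdeleRing (𝓞 K) K))} (hD : IsOpen D)
    (hDc : IsCompact (closure D)) : ℝ≥0 :=
  haveI := isMulLeftInvariant_archShadow (n := n) (K := K) hD
  haveI := isFiniteMeasureOnCompacts_archShadow (n := n) (K := K) hDc
  haarScalarFactor (archShadow n K D) (archHaar n K)

/-- **Uniqueness of Haar measure, applied**: for `D` open with compact closure and `F` continuous
of compact support with values in a Banach space,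
`∫ F d(archShadow D) = c_D • ∫ F d(archHaar)` (Mathlib's
`integral_isMulLeftInvariant_eq_smul_of_hasCompactSupport` for the real functionals `φ ∘ F`, and
separation by the dual). [folklore] -/
theorem integral_archShadow_eq_smul {D : Set (GL (Fin n) (FiniteAdeleRing (𝓞 K) K))} (hD : IsOpen D)
    (hDc : IsCompact (closure D)) {E' : Type*} [NormedAddCommGroup E'] [NormedSpace ℝ E'] [CompleteSpace E']
    {F : GL (Fin n) (mixedSpace K) → E'} (hF : Continuous F) (hFs : HasCompactSupport F) :
    ∫ h, F h ∂(archShadow n K D) = (archShadowConst (n := n) (K := K) hD hDc : ℝ) • ∫ h, F h ∂(archHaar n K) := by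
  haveI := isMulLeftInvariant_archShadow (n := n) (K := K) hD
  haveI := isFiniteMeasureOnCompacts_archShadow (n := n) (K := K) hDc
  refine (SeparatingDual.eq_iff_forall_dual_eq (R := ℝ)).2 fun φ => ?_
  have hφF : Continuous fun h => φ (F h) := φ.continuous.comp hF
  have hφFs : HasCompactSupport fun h => φ (F h) := hFs.comp_left (map_zero φ)
  have hint : Integrable F (archShadow n K D) := hF.integrable_of_hasCompactSupport hFs
  have hint' : Integrable F (archHaar n K) := hF.integrable_of_hasCompactSupport hFs
  rw [← φ.integral_comp_comm hint, map_smul, ← φ.integral_comp_comm hint',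
    integral_isMulLeftInvariant_eq_smul_of_hasCompactSupport (archShadow n K D) (archHaar n K) hφF hφFs,
    integral_smul_nnreal_measure, NNReal.smul_def]
  rfl

/-- **The adelic integral against `𝟙_D(g_f) F(g_∞)` is the `archShadow D`-integral of `F`.**
[folklore] -/
theorem integral_indicator_smul_comp_toMixed {D : Set (GL (Fin n) (FiniteAdeleRing (𝓞 K) K))} (hD : IsOpen D)
    {E' : Type*} [NormedAddCommGroup E'] [NormedSpace ℝ E'] [CompleteSpace E']
    {F : GL (Fin n) (mixedSpace K) → E'} (hF : Continuous F) :
    ∫ g : (AdelicGroupData.gl n K).Adelic,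
        ({g : (AdelicGroupData.gl n K).Adelic | GLn.sndHom n K g ∈ D}.indicator (fun _ => (1 : ℝ)) g) •
          F (GLn.toMixed n K g) ∂(adelicHaar n K) =
      ∫ h, F h ∂(archShadow n K D) := by
  set S : Set (AdelicGroupData.gl n K).Adelic := {g | GLn.sndHom n K g ∈ D} with hS
  have hSm : MeasurableSet S := (isOpen_setOf_sndHom_mem hD).measurableSet
  have h1 : (fun g : (AdelicGroupData.gl n K).Adelic => (S.indicator (fun _ => (1 : ℝ)) g) • F (GLn.toMixed n K g)) =
      S.indicator fun g => F (GLn.toMixed n K g) := by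
    funext g
    by_cases hg : g ∈ S
    · rw [indicator_of_mem hg, indicator_of_mem hg, one_smul]
    · rw [indicator_of_notMem hg, indicator_of_notMem hg, zero_smul]
  rw [h1, integral_indicator hSm, archShadow,
    integral_map measurable_toMixed'.aemeasurable (hF.aestronglyMeasurable)]

/-- **The pushforward formula**: for `D` open with compact closure and `F` continuous of compact
support, `∫_{GL_n(𝔸_K)} 𝟙_D(g_f) F(g_∞) dg = c_D • ∫_{GL_n(K_∞)} F dh`. [folklore] -/
theorem integral_indicator_smul_comp_toMixed_eq_smul {D : Set (GL (Fin n) (FiniteAdeleRing (𝓞 K) K))}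
    (hD : IsOpen D) (hDc : IsCompact (closure D))
    {E' : Type*} [NormedAddCommGroup E'] [NormedSpace ℝ E'] [CompleteSpace E']
    {F : GL (Fin n) (mixedSpace K) → E'} (hF : Continuous F) (hFs : HasCompactSupport F) :
    ∫ g : (AdelicGroupData.gl n K).Adelic,
        ({g : (AdelicGroupData.gl n K).Adelic | GLn.sndHom n K g ∈ D}.indicator (fun _ => (1 : ℝ)) g) •
          F (GLn.toMixed n K g) ∂(adelicHaar n K) =
      (archShadowConst (n := n) (K := K) hD hDc : ℝ) • ∫ h, F h ∂(archHaar n K) := by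
  rw [integral_indicator_smul_comp_toMixed hD hF, integral_archShadow_eq_smul hD hDc hF hFs]

/-- **`c_{U₀} > 0`** for a compact open subgroup `U₀`. [folklore] -/
theorem archShadowConst_pos (U₀ : Subgroup (GL (Fin n) (FiniteAdeleRing (𝓞 K) K)))
    (hU₀o : IsOpen (U₀ : Set (GL (Fin n) (FiniteAdeleRing (𝓞 K) K))))
    (hU₀c : IsCompact (U₀ : Set (GL (Fin n) (FiniteAdeleRing (𝓞 K) K)))) :
    0 < archShadowConst (n := n) (K := K) hU₀o
      (by rw [(U₀.isClosed_of_isOpen hU₀o).closure_eq]; exact hU₀c) := by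
  haveI := isHaarMeasure_archShadow U₀ hU₀o hU₀c
  unfold archShadowConst
  exact haarScalarFactor_pos_of_isHaarMeasure (archShadow n K (U₀ : Set (GL (Fin n) (FiniteAdeleRing (𝓞 K) K))))
    (archHaar n K)

end Pushforward

/-! ### 2. Real test functions on `G_∞` give test functions `β ⊗ 𝟙_{U₀}` on `GL_n(𝔸_K)`; smoothing by
them on the level piece is archimedean smoothing -/

section ArchToAdelic

variable (hcpt : isCompact_glFiniteIntegralLevel n K)
  {U₀ : Subgroup (GL (Fin n) (FiniteAdeleRing (𝓞 K) K))}

/-- `archLevelWeight` (of `CuspidalRepArchIsotypic`) is the tree's `adelicWeight` (of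
`HarishChandraConvolutionAdelic`), read on `(gl n K).Adelic`. [folklore] -/
theorem archLevelWeight_eq_adelicWeight (U₀ : Subgroup (GL (Fin n) (FiniteAdeleRing (𝓞 K) K)))
    (β : GL (Fin n) (mixedSpace K) → ℝ) :
    (fun g : (AdelicGroupData.gl n K).Adelic => archLevelWeight U₀ β g) = adelicWeight U₀ β := by
  funext g
  rw [adelicWeight_apply, archLevelWeight]
  rfl

/-- **`β ⊗ 𝟙_{U₀}` is a test function on `GL_n(𝔸_K)`** for `β` a real test function on `GL_n(K_∞)`
(continuous, compactly supported, smooth along `u exp X`) and `U₀` compact open — the tree's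
`isTestFunctionGL_adelicWeight`. [folklore] -/
theorem isTestFunctionGL_archLevelWeight {β : GL (Fin n) (mixedSpace K) → ℝ} (hβ : Continuous β)
    (hβs : HasCompactSupport β)
    (hβsm : ∀ u : GL (Fin n) (mixedSpace K), ContDiff ℝ ∞
      fun X : (archGroupGL n K).lie.toSubmodule => β (u * expGL (X : Matrix (Fin n) (Fin n) (mixedSpace K))))
    (hU₀o : IsOpen (U₀ : Set (GL (Fin n) (FiniteAdeleRing (𝓞 K) K))))
    (hU₀c : IsCompact (U₀ : Set (GL (Fin n) (FiniteAdeleRing (𝓞 K) K)))) :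
    IsTestFunctionGL n K (archLevelWeight U₀ β) := by
  have h := isTestFunctionGL_adelicWeight hU₀o hU₀c hβ hβs hβsm
  rwa [← archLevelWeight_eq_adelicWeight U₀ β] at h

/-- **Smoothness along `u exp X` from `IsArchTestFunction`** of the complexification: the real part of
a `C^∞` complex-valued function is `C^∞`. [folklore] -/
theorem contDiff_mul_expGL_of_isArchTestFunction {β : GL (Fin n) (mixedSpace K) → ℝ}
    (hβ : IsArchTestFunction n K fun h => (β h : ℂ)) (u : GL (Fin n) (mixedSpace K)) :
    ContDiff ℝ ∞ fun X : (archGroupGL n K).lie.toSubmodule =>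
      β (u * expGL (X : Matrix (Fin n) (Fin n) (mixedSpace K))) := by
  have h := hβ.isArchSmooth u
  have h' : ContDiff ℝ ∞ fun X : (archGroupGL n K).lie.toSubmodule =>
      Complex.reCLM ((β (u * expGL (X : Matrix (Fin n) (Fin n) (mixedSpace K))) : ℂ)) :=
    Complex.reCLM.contDiff.comp h
  simpa only [Complex.reCLM_apply, Complex.ofReal_re] using h'

variable {hcpt}
variable {E : Type*} [NormedAddCommGroup E] [InnerProductSpace ℂ E] [CompleteSpace E]
  {τ : ContRepresentation ℂ (AutomorphyDatum.gl n K hcpt).arch.carrier E}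
  (P : CuspidalAutomorphicRepGL n K μ)

/-- **Smoothing by `β ⊗ 𝟙_{U₀}` on the level piece is `c_{U₀}` times archimedean smoothing**:
for `x ∈ Π^{U₀}`, `R(β ⊗ 𝟙_{U₀}) x = c_{U₀} ∫_{GL_n(K_∞)} β(h) R((h,1)) x dh`
(`coe_archLevelOp_eq_integral` and the pushforward formula). [folklore] -/
theorem coe_smoothedVector_archLevelWeight_eq_smul {β : GL (Fin n) (mixedSpace K) → ℝ} (hβ : Continuous β)
    (hβs : HasCompactSupport β) (hU₀o : IsOpen (U₀ : Set (GL (Fin n) (FiniteAdeleRing (𝓞 K) K))))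
    (hU₀c : IsCompact (U₀ : Set (GL (Fin n) (FiniteAdeleRing (𝓞 K) K))))
    (W : ContRepresentation.ClosedSubrep ((AdelicGroupData.gl n K).rightRegular μ))
    (x : (levelPiece hcpt W U₀).toSubmodule) :
    ((smoothedVector W (archLevelWeight U₀ β) (levelPieceToW hcpt W U₀ x) : W.toSubmodule) :
        (AdelicGroupData.gl n K).L2 μ) =
      (archShadowConst (n := n) (K := K) hU₀o (by rw [(U₀.isClosed_of_isOpen hU₀o).closure_eq]; exact hU₀c) : ℝ) •
        ∫ h, (β h : ℂ) • archRegular hcpt μ (toArch hcpt h) (x : (AdelicGroupData.gl n K).L2 μ) ∂(archHaar n K) := by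
  have h1 := coe_archLevelOp_eq_integral hcpt W U₀ hβ hβs hU₀o hU₀c x
  rw [coe_archLevelOp_apply] at h1
  rw [h1]
  have hF : Continuous fun h : GL (Fin n) (mixedSpace K) =>
      (β h : ℂ) • archRegular hcpt μ (toArch hcpt h) (x : (AdelicGroupData.gl n K).L2 μ) :=
    (Complex.continuous_ofReal.comp hβ).smul
      ((isStronglyContinuous_archRegular (hcpt := hcpt) (μ := μ) (x : (AdelicGroupData.gl n K).L2 μ)).comp
        (continuous_id.subtype_mk _))
  have hFs : HasCompactSupport fun h : GL (Fin n) (mixedSpace K) =>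
      (β h : ℂ) • archRegular hcpt μ (toArch hcpt h) (x : (AdelicGroupData.gl n K).L2 μ) :=
    (hβs.comp_left Complex.ofReal_zero).smul_right
  rw [← integral_indicator_smul_comp_toMixed_eq_smul hU₀o _ hF hFs]
  refine congrArg (fun F : (AdelicGroupData.gl n K).Adelic → (AdelicGroupData.gl n K).L2 μ =>
    ∫ g, F g ∂(adelicHaar n K)) (funext fun g => ?_)
  change ((archLevelWeight U₀ β g : ℝ) : ℂ) • archRegular hcpt μ (toArch hcpt (GLn.toMixed n K g))
      (x : (AdelicGroupData.gl n K).L2 μ) =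
    ({g : (AdelicGroupData.gl n K).Adelic | GLn.sndHom n K g ∈ (U₀ : Set _)}.indicator (fun _ => (1 : ℝ)) g) •
      ((β (GLn.toMixed n K g) : ℂ) • archRegular hcpt μ (toArch hcpt (GLn.toMixed n K g))
        (x : (AdelicGroupData.gl n K).L2 μ))
  rw [archLevelWeight]
  by_cases hg : GLn.sndHom n K g ∈ U₀
  · rw [indicator_of_mem (show GLn.sndHom n K g ∈ (U₀ : Set _) from hg),
      indicator_of_mem (show g ∈ {g : (AdelicGroupData.gl n K).Adelic | GLn.sndHom n K g ∈ (U₀ : Set _)} from hg),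
      mul_one, one_smul]
  · rw [indicator_of_notMem (show GLn.sndHom n K g ∉ (U₀ : Set _) from hg),
      indicator_of_notMem (show g ∉ {g : (AdelicGroupData.gl n K).Adelic | GLn.sndHom n K g ∈ (U₀ : Set _)} from hg),
      mul_zero, Complex.ofReal_zero, zero_smul, zero_smul]

end ArchToAdelic


/-! ### 3. Intertwiners carry the Gårding space of `τ` into the Gårding space of `W`, compatibly with
`U(𝔤)`; transfer of continuous Whittaker functionals -/

section Transfer

/-- `(u, 1) ∈ N_n(𝔸_K)` for `u ∈ N_n(K_∞)` (entries of `(u, 1)`; a copy of the private lemma of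
`ArchGardingWhittaker` / of `ofInfinite_mem_adelicUnipotent` of `IwasawaCoordinatesAdelic`, which is
not imported). [folklore] -/
private theorem ofInfinite_mem_adelicUnipotent'' {u : GL (Fin n) (mixedSpace K)}
    (hu : u ∈ upperUnitriangular (Fin n) (mixedSpace K)) :
    GLn.ofInfinite n K u ∈ adelicUnipotent n K := by
  rw [mem_upperUnitriangular_iff] at hu ⊢
  obtain ⟨htri, hdiag⟩ := hu
  refine ⟨fun i j hij => ?_, fun i => ?_⟩
  · rw [GLn.coe_ofInfinite_apply, htri hij, map_zero, Matrix.one_apply_ne (show i ≠ j from ne_of_gt hij)]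
    rfl
  · rw [GLn.coe_ofInfinite_apply, hdiag i, map_one, Matrix.one_apply_eq]
    rfl

variable {hcpt : isCompact_glFiniteIntegralLevel n K}
  {E : Type*} [NormedAddCommGroup E] [InnerProductSpace ℂ E] [CompleteSpace E]
  {τ : ContRepresentation ℂ (AutomorphyDatum.gl n K hcpt).arch.carrier E}
  {W : ContRepresentation.ClosedSubrep ((AdelicGroupData.gl n K).rightRegular μ)}
  {U₀ : Subgroup (GL (Fin n) (FiniteAdeleRing (𝓞 K) K))}

/-- **An intertwiner corestricted to `W`**: `T̂ : E → W`, `T̂ e = T e`. [folklore] -/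
def corestrictW {T : E →L[ℂ] (AdelicGroupData.gl n K).L2 μ} (hT : T ∈ archIntertwiners hcpt τ W) :
    E →L[ℂ] W.toSubmodule :=
  T.codRestrict W.toSubmodule hT.1

omit [CompleteSpace E] in
/-- `(T̂ e : L²) = T e` (definitional). [folklore] -/
@[simp] theorem coe_corestrictW_apply {T : E →L[ℂ] (AdelicGroupData.gl n K).L2 μ}
    (hT : T ∈ archIntertwiners hcpt τ W) (e : E) :
    ((corestrictW hT e : W.toSubmodule) : (AdelicGroupData.gl n K).L2 μ) = T e := rfl

omit [CompleteSpace E] in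
/-- `‖T̂ e‖ = ‖T e‖`. [folklore] -/
theorem norm_corestrictW_apply {T : E →L[ℂ] (AdelicGroupData.gl n K).L2 μ}
    (hT : T ∈ archIntertwiners hcpt τ W) (e : E) : ‖corestrictW hT e‖ = ‖T e‖ := rfl

omit [CompleteSpace E] in
/-- **The intertwining identity through `W`**: `T̂ (τ(h) e) = R((h, 1))|_W (T̂ e)`. [folklore] -/
theorem corestrictW_apply_apply {T : E →L[ℂ] (AdelicGroupData.gl n K).L2 μ}
    (hT : T ∈ archIntertwiners hcpt τ W) (h : GL (Fin n) (mixedSpace K)) (e : E) :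
    corestrictW hT (τ (toArch hcpt h) e) = W.toContRep (GLn.ofInfinite n K h) (corestrictW hT e) :=
  Subtype.ext (hT.2 (toArch hcpt h) e)

/-- **`T (τ(β) e) = ∫ β(h) R((h,1)) (T e) dh`** for a bounded intertwiner `T : τ → W` and a continuous
compactly supported real `β` on `GL_n(K_∞)` (the intertwiner passes through the Bochner integral).
[folklore] -/
theorem apply_archSmoothing_eq_integral {T : E →L[ℂ] (AdelicGroupData.gl n K).L2 μ}
    (hT : T ∈ archIntertwiners hcpt τ W) (hτ : τ.IsStronglyContinuous)
    {β : GL (Fin n) (mixedSpace K) → ℝ} (hβ : Continuous β) (hβs : HasCompactSupport β) (e : E) :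
    T (archSmoothing hcpt τ (fun h => (β h : ℂ)) e) =
      ∫ h, (β h : ℂ) • archRegular hcpt μ (toArch hcpt h) (T e) ∂(archHaar n K) := by
  have hint : Integrable (fun h : GL (Fin n) (mixedSpace K) => (β h : ℂ) • τ (toArch hcpt h) e) (archHaar n K) :=
    integrable_smul_apply_toArch hcpt τ (α := fun h => (β h : ℂ)) (Complex.continuous_ofReal.comp hβ)
      (hβs.comp_left Complex.ofReal_zero) hτ e
  change T (∫ h, (β h : ℂ) • τ (toArch hcpt h) e ∂(archHaar n K)) = _
  rw [← T.integral_comp_comm hint]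
  congr 1 with h
  rw [ContinuousLinearMap.map_smul_of_tower, hT.2]

/-- **Archimedean smoothing through an intertwiner into the level piece is adelic smoothing**:
`c_{U₀} • T (τ(β) e) = R(β ⊗ 𝟙_{U₀}) (T e)` in `L²`, for `T : τ → W^{U₀}`. [folklore] -/
theorem smul_apply_archSmoothing_eq {T : E →L[ℂ] (AdelicGroupData.gl n K).L2 μ}
    (hT : T ∈ archIntertwinersLevel hcpt τ W U₀) (hτ : τ.IsStronglyContinuous)
    {β : GL (Fin n) (mixedSpace K) → ℝ} (hβ : Continuous β) (hβs : HasCompactSupport β)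
    (hU₀o : IsOpen (U₀ : Set (GL (Fin n) (FiniteAdeleRing (𝓞 K) K))))
    (hU₀c : IsCompact (U₀ : Set (GL (Fin n) (FiniteAdeleRing (𝓞 K) K)))) (e : E) :
    (archShadowConst (n := n) (K := K) hU₀o (by rw [(U₀.isClosed_of_isOpen hU₀o).closure_eq]; exact hU₀c) : ℝ) •
        T (archSmoothing hcpt τ (fun h => (β h : ℂ)) e) =
      ((smoothedVector W (archLevelWeight U₀ β)
          (levelPieceToW hcpt W U₀ ⟨T e, hT.2 e⟩) : W.toSubmodule) : (AdelicGroupData.gl n K).L2 μ) := by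
  rw [apply_archSmoothing_eq_integral hT.1 hτ hβ hβs e,
    coe_smoothedVector_archLevelWeight_eq_smul hβ hβs hU₀o hU₀c W ⟨T e, hT.2 e⟩]

/-- **Intertwiners into the level piece carry `τ(β) e` (real `β ∈ C_c^∞`) into the Gårding vectors
of level `U₀`**: `T̂ (τ(β) e) = c_{U₀}⁻¹ R(β ⊗ 𝟙_{U₀}) (T e) ∈ gardingSubspace W U₀`
(`β ⊗ 𝟙_{U₀}` is a test function left invariant under `(1, U₀)`). [folklore] -/
theorem corestrictW_archSmoothing_ofReal_mem_gardingSubspace {T : E →L[ℂ] (AdelicGroupData.gl n K).L2 μ}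
    (hT : T ∈ archIntertwinersLevel hcpt τ W U₀) (hτ : τ.IsStronglyContinuous)
    {β : GL (Fin n) (mixedSpace K) → ℝ} (hβ : Continuous β) (hβs : HasCompactSupport β)
    (hβsm : ∀ u : GL (Fin n) (mixedSpace K), ContDiff ℝ ∞
      fun X : (archGroupGL n K).lie.toSubmodule => β (u * expGL (X : Matrix (Fin n) (Fin n) (mixedSpace K))))
    (hU₀o : IsOpen (U₀ : Set (GL (Fin n) (FiniteAdeleRing (𝓞 K) K))))
    (hU₀c : IsCompact (U₀ : Set (GL (Fin n) (FiniteAdeleRing (𝓞 K) K)))) (e : E) :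
    corestrictW hT.1 (archSmoothing hcpt τ (fun h => (β h : ℂ)) e) ∈ gardingSubspace W U₀ := by
  set c : ℝ := (archShadowConst (n := n) (K := K) hU₀o
    (by rw [(U₀.isClosed_of_isOpen hU₀o).closure_eq]; exact hU₀c) : ℝ) with hc
  have hcpos : 0 < c := archShadowConst_pos U₀ hU₀o hU₀c
  have hmem := smoothedVector_mem_gardingSubspace (W := W) (U₀ := U₀)
    (isTestFunctionGL_archLevelWeight hβ hβs hβsm hU₀o hU₀c)
    (fun u hu g => archLevelWeight_ofFinite_mul β hu g) (levelPieceToW hcpt W U₀ ⟨T e, hT.2 e⟩)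
  have heq : corestrictW hT.1 (archSmoothing hcpt τ (fun h => (β h : ℂ)) e) =
      ((c⁻¹ : ℝ) : ℂ) • smoothedVector W (archLevelWeight U₀ β) (levelPieceToW hcpt W U₀ ⟨T e, hT.2 e⟩) := by
    apply Subtype.ext
    change T (archSmoothing hcpt τ (fun h => (β h : ℂ)) e) = ((c⁻¹ : ℝ) : ℂ) •
      ((smoothedVector W (archLevelWeight U₀ β) (levelPieceToW hcpt W U₀ ⟨T e, hT.2 e⟩) : W.toSubmodule) :
        (AdelicGroupData.gl n K).L2 μ)
    rw [← smul_apply_archSmoothing_eq hT hτ hβ hβs hU₀o hU₀c e, ← hc,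
      show ((c⁻¹ : ℝ) : ℂ) = algebraMap ℝ ℂ c⁻¹ from rfl, algebraMap_smul, smul_smul,
      inv_mul_cancel₀ hcpos.ne', one_smul]
  rw [heq]
  exact Submodule.smul_mem _ _ hmem

/-- Smoothness along `u exp X` of the real part of a test function. [folklore] -/
theorem contDiff_re_mul_expGL {α : GL (Fin n) (mixedSpace K) → ℂ} (hα : IsArchTestFunction n K α)
    (u : GL (Fin n) (mixedSpace K)) :
    ContDiff ℝ ∞ fun X : (archGroupGL n K).lie.toSubmodule =>
      (α (u * expGL (X : Matrix (Fin n) (Fin n) (mixedSpace K)))).re :=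
  Complex.reCLM.contDiff.comp (hα.isArchSmooth u)

/-- Smoothness along `u exp X` of the imaginary part of a test function. [folklore] -/
theorem contDiff_im_mul_expGL {α : GL (Fin n) (mixedSpace K) → ℂ} (hα : IsArchTestFunction n K α)
    (u : GL (Fin n) (mixedSpace K)) :
    ContDiff ℝ ∞ fun X : (archGroupGL n K).lie.toSubmodule =>
      (α (u * expGL (X : Matrix (Fin n) (Fin n) (mixedSpace K)))).im :=
  Complex.imCLM.contDiff.comp (hα.isArchSmooth u)

omit [CompleteSpace E] in
/-- `τ(α) e = τ(Re α) e + i τ(Im α) e` for a test function `α` (decomposition of the weight).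
[folklore] -/
theorem archSmoothing_eq_re_add_im {α : GL (Fin n) (mixedSpace K) → ℂ} (hα : IsArchTestFunction n K α)
    (hτ : τ.IsStronglyContinuous) (e : E) :
    archSmoothing hcpt τ α e = archSmoothing hcpt τ (fun h => ((α h).re : ℂ)) e +
      Complex.I • archSmoothing hcpt τ (fun h => ((α h).im : ℂ)) e := by
  have hre : Continuous fun h => ((α h).re : ℂ) :=
    Complex.continuous_ofReal.comp (Complex.continuous_re.comp hα.continuous)
  have him : Continuous fun h => ((α h).im : ℂ) :=
    Complex.continuous_ofReal.comp (Complex.continuous_im.comp hα.continuous)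
  have hres : HasCompactSupport fun h => ((α h).re : ℂ) :=
    (hα.hasCompactSupport.comp_left (g := fun z : ℂ => ((z.re : ℂ))) (by simp))
  have hims : HasCompactSupport fun h => ((α h).im : ℂ) :=
    (hα.hasCompactSupport.comp_left (g := fun z : ℂ => ((z.im : ℂ))) (by simp))
  have hdecomp : α = (fun h => ((α h).re : ℂ)) + Complex.I • fun h => ((α h).im : ℂ) := by
    funext h
    simp only [Pi.add_apply, Pi.smul_apply, smul_eq_mul]
    rw [mul_comm]
    exact (Complex.re_add_im (α h)).symm
  conv_lhs => rw [hdecomp]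
  rw [archSmoothing_add_weight hcpt τ hre hres (him.const_smul _) (hims.smul_left) hτ,
    archSmoothing_smul_weight]

/-- **Intertwiners into the level piece carry the Gårding space of `τ` into the Gårding vectors of
level `U₀`**: `T̂(archGardingSpace τ) ≤ gardingSubspace W U₀`. [folklore] -/
theorem map_corestrictW_archGardingSpace_le {T : E →L[ℂ] (AdelicGroupData.gl n K).L2 μ}
    (hT : T ∈ archIntertwinersLevel hcpt τ W U₀) (hτ : τ.IsStronglyContinuous)
    (hU₀o : IsOpen (U₀ : Set (GL (Fin n) (FiniteAdeleRing (𝓞 K) K))))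
    (hU₀c : IsCompact (U₀ : Set (GL (Fin n) (FiniteAdeleRing (𝓞 K) K)))) :
    (archGardingSpace hcpt τ).map (corestrictW hT.1).toLinearMap ≤ gardingSubspace W U₀ := by
  rw [Submodule.map_le_iff_le_comap]
  refine Submodule.span_le.2 ?_
  rintro _ ⟨α, e, hα, rfl⟩
  change corestrictW hT.1 (archSmoothing hcpt τ α e) ∈ gardingSubspace W U₀
  rw [archSmoothing_eq_re_add_im hα hτ e, map_add, map_smul]
  refine Submodule.add_mem _ ?_ (Submodule.smul_mem _ _ ?_)
  · exact corestrictW_archSmoothing_ofReal_mem_gardingSubspace hT hτ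
      (Complex.continuous_re.comp hα.continuous)
      (hα.hasCompactSupport.comp_left (g := Complex.re) Complex.zero_re)
      (contDiff_re_mul_expGL hα) hU₀o hU₀c e
  · exact corestrictW_archSmoothing_ofReal_mem_gardingSubspace hT hτ
      (Complex.continuous_im.comp hα.continuous)
      (hα.hasCompactSupport.comp_left (g := Complex.im) Complex.zero_im)
      (contDiff_im_mul_expGL hα) hU₀o hU₀c e

/-- Pointwise form: `T̂ v ∈ gardingSubspace W U₀` for `v` in the Gårding space of `τ`. [folklore] -/
theorem corestrictW_mem_gardingSubspace {T : E →L[ℂ] (AdelicGroupData.gl n K).L2 μ}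
    (hT : T ∈ archIntertwinersLevel hcpt τ W U₀) (hτ : τ.IsStronglyContinuous)
    (hU₀o : IsOpen (U₀ : Set (GL (Fin n) (FiniteAdeleRing (𝓞 K) K))))
    (hU₀c : IsCompact (U₀ : Set (GL (Fin n) (FiniteAdeleRing (𝓞 K) K)))) {v : E}
    (hv : v ∈ archGardingSpace hcpt τ) : corestrictW hT.1 v ∈ gardingSubspace W U₀ :=
  map_corestrictW_archGardingSpace_le hT hτ hU₀o hU₀c ⟨v, hv, rfl⟩

/-- **`U(𝔤)` commutes with intertwiners**: `π(w) (T̂ v) = T̂ (τ(w) v)` for `v` in the Gårding space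
of `τ` (the strong derivative passes through the bounded `T̂`, `T̂ ∘ τ(exp tX) = R((exp tX, 1)) ∘ T̂`).
[folklore] -/
theorem wordArchDeriv_corestrictW {T : E →L[ℂ] (AdelicGroupData.gl n K).L2 μ}
    (hT : T ∈ archIntertwiners hcpt τ W) (hτ : τ.IsStronglyContinuous) {v : E}
    (hv : v ∈ archGardingSpace hcpt τ) :
    ∀ w : List (Matrix (Fin n) (Fin n) (mixedSpace K)),
      wordArchDeriv W w (corestrictW hT v) = corestrictW hT (archWordDerivE hcpt τ w v)
  | [] => rfl
  | X :: w => by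
    rw [wordArchDeriv_cons, archWordDerivE_cons, wordArchDeriv_corestrictW hT hτ hv w, archDeriv_def]
    have hu := archWordDerivE_mem_archGardingSpace hτ w hv
    have hd := hasDerivAt_apply_expGL_of_mem_archGardingSpace hτ hu X
    have hcomp := ((corestrictW hT).restrictScalars ℝ).hasFDerivAt.comp_hasDerivAt (0 : ℝ) hd
    have hfun : (fun t : ℝ => W.toContRep (GLn.ofInfinite n K (expGL (t • X)))
        (corestrictW hT (archWordDerivE hcpt τ w v))) =
        ⇑((corestrictW hT).restrictScalars ℝ) ∘
          fun t : ℝ => τ (toArch hcpt (expGL (t • X))) (archWordDerivE hcpt τ w v) := by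
      funext t
      exact (corestrictW_apply_apply hT (expGL (t • X)) _).symm
    rw [hfun, hcomp.deriv]
    rfl

/-- **Transfer of a functional along an intertwiner**: for `ℓ` a linear functional on the Gårding
space of `W` and `T : τ → W^{U₀}` a bounded `G_∞`-intertwiner, the functional `v ↦ ℓ(T̂ v)` on the
Gårding space of `τ` (`T̂` carries it into `gardingSubspace W U₀ ≤ gardingSpace W`). This is the map
`λ ↦ λ ∘ (π_∞ ↪ π)` of the global-to-local reduction (Cogdell (2004), §1.2, proof of Cor. 1.4;
Bump (1997), proof of Thm. 3.5.2). [cite: CogdellAnalyticTheory2004, §1.2] -/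
def transferFunctional (ℓ : gardingSpace W →ₗ[ℂ] ℂ) {T : E →L[ℂ] (AdelicGroupData.gl n K).L2 μ}
    (hT : T ∈ archIntertwinersLevel hcpt τ W U₀) (hτ : τ.IsStronglyContinuous)
    (hU₀o : IsOpen (U₀ : Set (GL (Fin n) (FiniteAdeleRing (𝓞 K) K))))
    (hU₀c : IsCompact (U₀ : Set (GL (Fin n) (FiniteAdeleRing (𝓞 K) K)))) :
    archGardingSpace hcpt τ →ₗ[ℂ] ℂ where
  toFun v := ℓ ⟨corestrictW hT.1 v,
    gardingSubspace_le_gardingSpace U₀ (corestrictW_mem_gardingSubspace hT hτ hU₀o hU₀c v.2)⟩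
  map_add' v v' := by
    rw [← map_add]
    congr 1
    exact Subtype.ext (map_add (corestrictW hT.1) (v : E) (v' : E))
  map_smul' c v := by
    rw [RingHom.id_apply, ← map_smul]
    congr 1
    exact Subtype.ext (map_smul (corestrictW hT.1) c (v : E))

/-- Unfolding of `transferFunctional`. [folklore] -/
theorem transferFunctional_apply (ℓ : gardingSpace W →ₗ[ℂ] ℂ) {T : E →L[ℂ] (AdelicGroupData.gl n K).L2 μ}
    (hT : T ∈ archIntertwinersLevel hcpt τ W U₀) (hτ : τ.IsStronglyContinuous)
    (hU₀o : IsOpen (U₀ : Set (GL (Fin n) (FiniteAdeleRing (𝓞 K) K))))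
    (hU₀c : IsCompact (U₀ : Set (GL (Fin n) (FiniteAdeleRing (𝓞 K) K)))) (v : archGardingSpace hcpt τ) :
    transferFunctional ℓ hT hτ hU₀o hU₀c v = ℓ ⟨corestrictW hT.1 v,
      gardingSubspace_le_gardingSpace U₀ (corestrictW_mem_gardingSubspace hT hτ hU₀o hU₀c v.2)⟩ := rfl

/-- **A continuous global `ψ`-Whittaker functional restricts, along any intertwiner
`T : τ → W^{U₀}`, to a continuous `ψ_∞`-Whittaker functional on the Gårding space of `τ`**
(`ψ_∞ = ψ_N ∘ (u ↦ (u,1))`; the `U(𝔤)`-seminorm bound transfers because `T̂` is bounded and commutes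
with `U(𝔤)`). Cogdell (2004), §1.2 (proof of Cor. 1.4: "`Λ ∘ (π_v ↪ π)` is a Whittaker functional
on `V_{π_v}`"); Getz–Hahn (2024), proof of Thm. 11.3.4. [cite: CogdellAnalyticTheory2004, §1.2] -/
theorem isArchContWhittakerFunctional_transferFunctional {ℓ : gardingSpace W →ₗ[ℂ] ℂ}
    (hℓ : IsContWhittakerFunctional W (adeleAddChar K) ℓ) {T : E →L[ℂ] (AdelicGroupData.gl n K).L2 μ}
    (hT : T ∈ archIntertwinersLevel hcpt τ W U₀) (hτ : τ.IsStronglyContinuous)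
    (hU₀o : IsOpen (U₀ : Set (GL (Fin n) (FiniteAdeleRing (𝓞 K) K))))
    (hU₀c : IsCompact (U₀ : Set (GL (Fin n) (FiniteAdeleRing (𝓞 K) K)))) :
    IsArchContWhittakerFunctional hcpt τ hτ (transferFunctional ℓ hT hτ hU₀o hU₀c) where
  map_unipotent u v := by
    let u' : ↥(adelicUnipotent n K) := ⟨GLn.ofInfinite n K u, ofInfinite_mem_adelicUnipotent'' u.2⟩
    let v' : gardingSpace W := ⟨corestrictW hT.1 v,
      gardingSubspace_le_gardingSpace U₀ (corestrictW_mem_gardingSubspace hT hτ hU₀o hU₀c v.2)⟩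
    have h1 : (⟨corestrictW hT.1 (τ (toArch hcpt (u : GL (Fin n) (mixedSpace K))) v),
        gardingSubspace_le_gardingSpace U₀ (corestrictW_mem_gardingSubspace hT hτ hU₀o hU₀c
          (apply_mem_archGardingSpace hτ _ v.2))⟩ : gardingSpace W) =
        ⟨W.toContRep (u' : GL (Fin n) (AdeleRing (𝓞 K) K)) v', toContRep_mem_gardingSpace _ v'.2⟩ :=
      Subtype.ext (corestrictW_apply_apply hT.1 u v)
    exact (congrArg ℓ h1).trans (hℓ.map_unipotent u' v')
  norm_le := by
    obtain ⟨C, 𝒮, hC, hb⟩ := hℓ.norm_le U₀ hU₀o hU₀c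
    refine ⟨C * ‖T‖, 𝒮, by positivity, fun v => ?_⟩
    have hv : ‖transferFunctional ℓ hT hτ hU₀o hU₀c v‖ ≤
        C * ∑ w ∈ 𝒮, ‖wordArchDeriv W w (corestrictW hT.1 v)‖ :=
      hb ⟨corestrictW hT.1 v, _⟩ (corestrictW_mem_gardingSubspace hT hτ hU₀o hU₀c v.2)
    refine hv.trans ?_
    rw [mul_assoc]
    refine mul_le_mul_of_nonneg_left ?_ hC
    rw [Finset.mul_sum]
    refine Finset.sum_le_sum fun w _ => ?_
    rw [wordArchDeriv_corestrictW hT.1 hτ v.2 w, norm_corestrictW_apply]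
    exact T.le_opNorm _


end Transfer


/-! ### 4. Adjoints of intertwiners carry the Gårding vectors of level `U₀` into the Gårding space
of `τ` (coset decomposition of a `(1, U₀)`-left-invariant test function) -/

section AdjointTransfer

variable {hcpt : isCompact_glFiniteIntegralLevel n K}
  {E : Type*} [NormedAddCommGroup E] [InnerProductSpace ℂ E] [CompleteSpace E]
  {τ : ContRepresentation ℂ (AutomorphyDatum.gl n K hcpt).arch.carrier E}
  {W : ContRepresentation.ClosedSubrep ((AdelicGroupData.gl n K).rightRegular μ)}
  {U₀ : Subgroup (GL (Fin n) (FiniteAdeleRing (𝓞 K) K))}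

/-- `archRegular (h) x = R((h, 1)) x` (definitional). [folklore] -/
theorem archRegular_toArch_apply (h : GL (Fin n) (mixedSpace K)) (x : (AdelicGroupData.gl n K).L2 μ) :
    archRegular hcpt μ (toArch hcpt h) x = (AdelicGroupData.gl n K).rightRegular μ (GLn.ofInfinite n K h) x :=
  rfl

/-- **`T† ∘ R((1, u)) = T†` for `u ∈ U₀`** when `T : τ → W^{U₀}` (the range of `T` is fixed by
`(1, U₀)` and `R` is unitary). [folklore] -/
theorem adjoint_rightRegular_ofFinite_apply {T : E →L[ℂ] (AdelicGroupData.gl n K).L2 μ}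
    (hT : T ∈ archIntertwinersLevel hcpt τ W U₀) {u : GL (Fin n) (FiniteAdeleRing (𝓞 K) K)}
    (hu : u ∈ U₀) (x : (AdelicGroupData.gl n K).L2 μ) :
    ContinuousLinearMap.adjoint T ((AdelicGroupData.gl n K).rightRegular μ (GLn.ofFinite n K u) x) =
      ContinuousLinearMap.adjoint T x := by
  refine ext_inner_right ℂ fun e => ?_
  rw [ContinuousLinearMap.adjoint_inner_left, ContinuousLinearMap.adjoint_inner_left]
  conv_lhs => rw [← (mem_levelPiece_iff.mp (hT.2 e)).2 u hu]
  exact ((AdelicGroupData.gl n K).isUnitary_rightRegular μ).inner_map_map _ _ _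

/-- **`T† (R(g) x) = τ(g_∞) T† (R((1, y)) x)` when `g_f = u y`, `u ∈ U₀`** (`g = (g_∞,1)(1,u)(1,y)`,
`T†` intertwines `R|_{G_∞}` with `τ` and is invariant under `R((1, U₀))`). [folklore] -/
theorem adjoint_rightRegular_apply_of_sndHom_eq {T : E →L[ℂ] (AdelicGroupData.gl n K).L2 μ}
    (hτu : τ.IsUnitary) (hT : T ∈ archIntertwinersLevel hcpt τ W U₀)
    {g : GL (Fin n) (AdeleRing (𝓞 K) K)} {u y : GL (Fin n) (FiniteAdeleRing (𝓞 K) K)} (hu : u ∈ U₀)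
    (hg : GLn.sndHom n K g = u * y) (x : (AdelicGroupData.gl n K).L2 μ) :
    ContinuousLinearMap.adjoint T ((AdelicGroupData.gl n K).rightRegular μ g x) =
      τ (toArch hcpt (GLn.toMixed n K g))
        (ContinuousLinearMap.adjoint T ((AdelicGroupData.gl n K).rightRegular μ (GLn.ofFinite n K y) x)) := by
  have hfac : g = GLn.ofInfinite n K (GLn.toMixed n K g) * (GLn.ofFinite n K u * GLn.ofFinite n K y) := by
    conv_lhs => rw [← GLn.ofInfinite_toMixed_mul_ofFinite_sndHom (n := n) (K := K) g, hg, map_mul]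
  conv_lhs => rw [hfac]
  rw [rightRegular_mul_GL, rightRegular_mul_GL, ContinuousLinearMap.comp_apply,
    ContinuousLinearMap.comp_apply, ← archRegular_toArch_apply, adjoint_apply_archRegular hτu hT.1,
    adjoint_rightRegular_ofFinite_apply hT hu]

/-- **Slices of an adelic test function are archimedean test functions**: for `η ∈ C_c^∞(GL_n(𝔸_K))`
and `y ∈ GL_n(𝔸_K^∞)`, `h ↦ η((h, 1)(1, y))` is in `C_c^∞(GL_n(K_∞))`. [folklore] -/
theorem isArchTestFunction_slice {η : GL (Fin n) (AdeleRing (𝓞 K) K) → ℝ} (hη : IsTestFunctionGL n K η)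
    (y : GL (Fin n) (FiniteAdeleRing (𝓞 K) K)) :
    IsArchTestFunction n K fun h => (η (GLn.ofInfinite n K h * GLn.ofFinite n K y) : ℂ) := by
  refine ⟨Complex.continuous_ofReal.comp
      (hη.continuous.comp ((GLn.continuous_ofInfinite n K).mul continuous_const)), ?_, fun u => ?_⟩
  · refine HasCompactSupport.intro (hη.hasCompactSupport.image (GLn.continuous_toMixed (n := n) (K := K)))
      fun h hh => ?_
    by_contra hne
    refine hh ⟨GLn.ofInfinite n K h * GLn.ofFinite n K y, subset_tsupport _ ?_, ?_⟩
    · rw [Function.mem_support]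
      exact fun h0 => hne (by rw [h0, Complex.ofReal_zero])
    · rw [map_mul, GLn.toMixed_ofInfinite, GLn.toMixed_ofFinite, mul_one]
  · have h := hη.2.2.1 (GLn.ofInfinite n K u * GLn.ofFinite n K y)
    have hfun : (fun X : (archGroupGL n K).lie.toSubmodule =>
        (fun h => (η (GLn.ofInfinite n K h * GLn.ofFinite n K y) : ℂ))
          (u * (archGroupGL n K).carrier.subtype ((archGroupGL n K).expMem ⟨X, X.2⟩))) =
        fun X : (archGroupGL n K).lie.toSubmodule => (fun g => (η g : ℂ))
          (GLn.ofInfinite n K u * GLn.ofFinite n K y *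
            GLn.ofInfinite n K ((archGroupGL n K).carrier.subtype ((archGroupGL n K).expMem ⟨X, X.2⟩))) := by
      funext X
      dsimp only
      rw [map_mul, mul_assoc, mul_assoc, (GLn.commute_ofInfinite_ofFinite _ y).eq]
    change ContDiff ℝ ∞ fun X : (archGroupGL n K).lie.toSubmodule =>
        (fun h => (η (GLn.ofInfinite n K h * GLn.ofFinite n K y) : ℂ))
          (u * (archGroupGL n K).carrier.subtype ((archGroupGL n K).expMem ⟨X, X.2⟩))
    rw [hfun]
    exact h

/-- **Adjoints of intertwiners carry smoothed vectors `R(η) f`, `η` left invariant under `(1, U₀)`,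
into the Gårding space of `τ`**: writing `supp η ⊆ ⋃_{q} G_∞ × U₀ y_q` (finitely many right cosets,
`U₀` open, `supp η` compact), `η = Σ_q β_q ⊗ 𝟙_{U₀ y_q}` with `β_q(h) = η((h,1)(1,y_q)) ∈ C_c^∞(G_∞)`,
and `T† R(β_q ⊗ 𝟙_{U₀ y_q}) f = c_q · τ(β_q) (T† R((1,y_q)) f)` (pushforward of the Haar measure of
the slab `G_∞ × U₀ y_q`). This is the level-`U₀` form of "`V_sm = π_∞^sm ⊗ π_f^{U₀}`"
(Cogdell (2004), §1.2; Borel–Jacquet (1979), §4.6; Garrett (2018), §7.3: `C_c^∞(G_𝔸)` is spanned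
by the `f_∞ ⊗ f_fin`). [cite: BorelJacquet1979, §4.6] -/
theorem adjoint_coe_smoothedVector_mem_archGardingSpace {T : E →L[ℂ] (AdelicGroupData.gl n K).L2 μ}
    (hτu : τ.IsUnitary) (hτ : τ.IsStronglyContinuous) (hT : T ∈ archIntertwinersLevel hcpt τ W U₀)
    (hU₀o : IsOpen (U₀ : Set (GL (Fin n) (FiniteAdeleRing (𝓞 K) K))))
    (hU₀c : IsCompact (U₀ : Set (GL (Fin n) (FiniteAdeleRing (𝓞 K) K))))
    {η : GL (Fin n) (AdeleRing (𝓞 K) K) → ℝ} (hη : IsTestFunctionGL n K η)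
    (hleft : ∀ u ∈ U₀, ∀ g : GL (Fin n) (AdeleRing (𝓞 K) K), η (GLn.ofFinite n K u * g) = η g)
    (f : W.toSubmodule) :
    ContinuousLinearMap.adjoint T ((smoothedVector W η f : W.toSubmodule) : (AdelicGroupData.gl n K).L2 μ) ∈
      archGardingSpace hcpt τ := by
  classical
  haveI : DiscreteTopology (GL (Fin n) (FiniteAdeleRing (𝓞 K) K) ⧸ U₀) :=
    QuotientGroup.discreteTopology hU₀o
  -- the index of the right coset `U₀ z` of `z`, through `z ↦ z⁻¹ U₀`
  set κ : GL (Fin n) (FiniteAdeleRing (𝓞 K) K) → GL (Fin n) (FiniteAdeleRing (𝓞 K) K) ⧸ U₀ :=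
    fun z => ((z⁻¹ : GL (Fin n) (FiniteAdeleRing (𝓞 K) K)) : GL (Fin n) (FiniteAdeleRing (𝓞 K) K) ⧸ U₀) with hκ
  have hκc : Continuous κ := QuotientGroup.continuous_mk.comp continuous_inv
  -- representatives `y q` of the right cosets: `κ z = q ↔ z (y q)⁻¹ ∈ U₀`
  set y : GL (Fin n) (FiniteAdeleRing (𝓞 K) K) ⧸ U₀ → GL (Fin n) (FiniteAdeleRing (𝓞 K) K) :=
    fun q => (Quotient.out q : GL (Fin n) (FiniteAdeleRing (𝓞 K) K))⁻¹ with hy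
  have hκ_iff : ∀ q z, κ z = q ↔ z * (y q)⁻¹ ∈ U₀ := by
    intro q z
    rw [hy, inv_inv, hκ]
    dsimp only
    conv_lhs => rw [← QuotientGroup.out_eq' q]
    rw [QuotientGroup.eq, inv_inv]
  -- the pieces `D q = U₀ (y q)`, clopen with compact closure
  set D : GL (Fin n) (FiniteAdeleRing (𝓞 K) K) ⧸ U₀ → Set (GL (Fin n) (FiniteAdeleRing (𝓞 K) K)) :=
    fun q => κ ⁻¹' {q} with hD
  have hDo : ∀ q, IsOpen (D q) := fun q => (isOpen_discrete {q}).preimage hκc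
  have hD_eq : ∀ q, D q = (fun z => z * (y q)⁻¹) ⁻¹' (U₀ : Set _) := fun q =>
    Set.ext fun z => hκ_iff q z
  have hDcl : ∀ q, IsClosed (D q) := fun q => by
    rw [hD_eq]
    exact (U₀.isClosed_of_isOpen hU₀o).preimage (continuous_id.mul continuous_const)
  have hDc : ∀ q, IsCompact (closure (D q)) := fun q => by
    rw [(hDcl q).closure_eq, hD_eq]
    exact (Homeomorph.mulRight (y q)⁻¹).isCompact_preimage.2 hU₀c
  -- the finite set of cosets meeting the support
  have hfin : ((fun g : GL (Fin n) (AdeleRing (𝓞 K) K) => κ (GLn.sndHom n K g)) '' tsupport η).Finite :=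
    (hη.hasCompactSupport.image (hκc.comp continuous_sndHom')).finite_of_discrete
  set t := hfin.toFinset with ht
  -- the pieces `η_q = η · 𝟙_{G_∞ × D q}` of `η`
  set ηq : GL (Fin n) (FiniteAdeleRing (𝓞 K) K) ⧸ U₀ → (AdelicGroupData.gl n K).Adelic → ℝ :=
    fun q g => {g : (AdelicGroupData.gl n K).Adelic | GLn.sndHom n K g ∈ D q}.indicator η g with hηq
  have hclo : ∀ q, IsClopen {g : (AdelicGroupData.gl n K).Adelic | GLn.sndHom n K g ∈ D q} := fun q =>
    ⟨(hDcl q).preimage continuous_sndHom', (hDo q).preimage continuous_sndHom'⟩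
  have hηqc : ∀ q, Continuous (ηq q) := fun q => (hclo q).continuous_indicator hη.continuous
  have hηqs : ∀ q, HasCompactSupport (ηq q) := fun q =>
    hη.hasCompactSupport.mono fun g hg => by
      rw [Function.mem_support] at hg ⊢
      exact fun h0 => hg (Set.indicator_apply_eq_zero.2 fun _ => h0)
  have hηq_apply : ∀ q (g : (AdelicGroupData.gl n K).Adelic),
      ηq q g = if κ (GLn.sndHom n K g) = q then η g else 0 := by
    intro q g
    simp only [hηq, hD, Set.indicator_apply, Set.mem_setOf_eq, Set.mem_preimage, Set.mem_singleton_iff]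
  have hsum : η = fun g => ∑ q ∈ t, ηq q g := by
    funext x
    by_cases hx : η x = 0
    · simp only [hηq_apply, hx, ite_self, Finset.sum_const_zero]
    · have hmem : κ (GLn.sndHom n K x) ∈ t := by
        rw [ht, Set.Finite.mem_toFinset]
        exact ⟨x, subset_tsupport _ (Function.mem_support.2 hx), rfl⟩
      rw [Finset.sum_eq_single_of_mem (κ (GLn.sndHom n K x)) hmem fun q _ hq => by
        rw [hηq_apply, if_neg (Ne.symm hq)]]
      rw [hηq_apply, if_pos rfl]
  -- `R(η) f = Σ_q R(η_q) f`
  have hsv : smoothedVector W η f = ∑ q ∈ t, smoothedVector W (ηq q) f := by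
    conv_lhs => rw [hsum]
    exact smoothedVector_finset_sum_weight W t hηqc hηqs f
  rw [hsv, Submodule.coe_sum, _root_.map_sum]
  refine Submodule.sum_mem _ fun q _ => ?_
  -- the piece `q`: `T† R(η_q) f = c_q • τ(β_q) (T† R((1, y_q)) f)`
  set xq : E := ContinuousLinearMap.adjoint T
    ((AdelicGroupData.gl n K).rightRegular μ (GLn.ofFinite n K (y q)) (f : (AdelicGroupData.gl n K).L2 μ)) with hxq
  set βq : GL (Fin n) (mixedSpace K) → ℝ := fun h => η (GLn.ofInfinite n K h * GLn.ofFinite n K (y q)) with hβq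
  have hβ : IsArchTestFunction n K fun h => (βq h : ℂ) := isArchTestFunction_slice hη (y q)
  set F : GL (Fin n) (mixedSpace K) → E := fun h => (βq h : ℂ) • τ (toArch hcpt h) xq with hF
  have hFc : Continuous F := hβ.continuous.smul (continuous_apply_toArch hcpt τ hτ xq)
  have hFs : HasCompactSupport F := hβ.hasCompactSupport.smul_right
  have hint : Integrable (fun g : (AdelicGroupData.gl n K).Adelic => (ηq q g : ℂ) •
      (AdelicGroupData.gl n K).rightRegular μ g (f : (AdelicGroupData.gl n K).L2 μ)) (adelicHaar n K) := by
    refine Continuous.integrable_of_hasCompactSupport ?_ ?_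
    · exact (Complex.continuous_ofReal.comp (hηqc q)).smul
        ((AdelicGroupData.isStronglyContinuous_rightRegular_holds (AdelicGroupData.gl n K) μ) _)
    · exact ((hηqs q).comp_left Complex.ofReal_zero).smul_right
  have hpt : ∀ g : (AdelicGroupData.gl n K).Adelic,
      ContinuousLinearMap.adjoint T ((ηq q g : ℂ) •
        (AdelicGroupData.gl n K).rightRegular μ g (f : (AdelicGroupData.gl n K).L2 μ)) =
      ({g : (AdelicGroupData.gl n K).Adelic | GLn.sndHom n K g ∈ D q}.indicator (fun _ => (1 : ℝ)) g) •
        F (GLn.toMixed n K g) := by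
    intro g
    rw [hηq_apply]
    simp only [Set.indicator_apply, Set.mem_setOf_eq]
    by_cases hm : κ (GLn.sndHom n K g) = q
    · have hm' : GLn.sndHom n K g ∈ D q := hm
      rw [if_pos hm, if_pos hm', one_smul, map_smul, hF]
      dsimp only
      have hu : GLn.sndHom n K g * (y q)⁻¹ ∈ U₀ := (hκ_iff q _).mp hm
      have hg : GLn.sndHom n K g = GLn.sndHom n K g * (y q)⁻¹ * y q := by rw [inv_mul_cancel_right]
      rw [adjoint_rightRegular_apply_of_sndHom_eq hτu hT hu hg, hβq]
      dsimp only
      congr 2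
      have hfac : g = GLn.ofFinite n K (GLn.sndHom n K g * (y q)⁻¹) *
          (GLn.ofInfinite n K (GLn.toMixed n K g) * GLn.ofFinite n K (y q)) := by
        rw [← mul_assoc, ← (GLn.commute_ofInfinite_ofFinite _ _).eq, mul_assoc, ← map_mul,
          inv_mul_cancel_right, GLn.ofInfinite_toMixed_mul_ofFinite_sndHom]
      conv_lhs => rw [hfac, hleft _ hu]
    · have hm' : GLn.sndHom n K g ∉ D q := hm
      rw [if_neg hm, if_neg hm', zero_smul, Complex.ofReal_zero, zero_smul, map_zero]
  rw [coe_smoothedVector W (hηqc q) (hηqs q) f,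
    ← (ContinuousLinearMap.adjoint T).integral_comp_comm hint]
  simp_rw [hpt]
  rw [integral_indicator_smul_comp_toMixed_eq_smul (hDo q) (hDc q) hFc hFs]
  exact Submodule.smul_mem _ _ (archSmoothing_mem_archGardingSpace (hcpt := hcpt) (τ := τ) hβ xq)

/-- **Adjoints of intertwiners carry the Gårding vectors of level `U₀` into the Gårding space of
`τ`**: `T†(gardingSubspace W U₀) ≤ archGardingSpace τ` for `T : τ → W^{U₀}`. [folklore] -/
theorem adjoint_mem_archGardingSpace_of_mem_gardingSubspace {T : E →L[ℂ] (AdelicGroupData.gl n K).L2 μ}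
    (hτu : τ.IsUnitary) (hτ : τ.IsStronglyContinuous) (hT : T ∈ archIntertwinersLevel hcpt τ W U₀)
    (hU₀o : IsOpen (U₀ : Set (GL (Fin n) (FiniteAdeleRing (𝓞 K) K))))
    (hU₀c : IsCompact (U₀ : Set (GL (Fin n) (FiniteAdeleRing (𝓞 K) K)))) {v : W.toSubmodule}
    (hv : v ∈ gardingSubspace W U₀) :
    ContinuousLinearMap.adjoint T (v : (AdelicGroupData.gl n K).L2 μ) ∈ archGardingSpace hcpt τ := by
  induction hv using Submodule.span_induction with
  | mem v hv =>
    obtain ⟨η, f, hη, hleft, rfl⟩ := hv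
    exact adjoint_coe_smoothedVector_mem_archGardingSpace hτu hτ hT hU₀o hU₀c hη hleft f
  | zero => rw [Submodule.coe_zero, map_zero]; exact Submodule.zero_mem _
  | add v v' _ _ hv hv' => rw [Submodule.coe_add, map_add]; exact Submodule.add_mem _ hv hv'
  | smul c v _ hv => rw [Submodule.coe_smul, map_smul]; exact Submodule.smul_mem _ c hv

/-- **Gårding vectors of level `U₀` lie in the level piece `W^{U₀}`** (`R(η) f` is fixed by `(1, U₀)`
for `η` left invariant under `(1, U₀)`, `smoothedVector_mem_fixedVectors`). [folklore] -/
theorem coe_mem_levelPiece_of_mem_gardingSubspace {v : W.toSubmodule} (hv : v ∈ gardingSubspace W U₀) :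
    (v : (AdelicGroupData.gl n K).L2 μ) ∈ levelPiece hcpt W U₀ := by
  induction hv using Submodule.span_induction with
  | mem v hv =>
    obtain ⟨η, f, hη, hleft, rfl⟩ := hv
    refine mem_levelPiece_iff.mpr ⟨(smoothedVector W η f).2, fun u hu => ?_⟩
    have hfix := smoothedVector_mem_fixedVectors W hη.continuous hη.hasCompactSupport
      (Kf := U₀.map (GLn.ofFinite n K)) (by rintro _ ⟨u, hu, rfl⟩ g; exact hleft u hu g) f
    rw [ContRepresentation.ClosedSubrep.mem_fixedVectors] at hfix
    exact congrArg Subtype.val (hfix _ ⟨u, hu, rfl⟩)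
  | zero => exact Submodule.zero_mem _
  | add v v' _ _ hv hv' => exact Submodule.add_mem _ hv hv'
  | smul c v _ hv => exact Submodule.smul_mem _ c hv

/-- **Level-`U₀` Gårding vectors decompose along the archimedean isotypic structure with Gårding
coefficients**: with `S_1, …, S_k` the Schur-orthonormal intertwiners of
`exists_levelPiece_decomposition`, every `v ∈ gardingSubspace Π U₀` is `Σ_i S_i u_i` with
`u_i = S_i† v` in the Gårding space of `τ`. [folklore] -/
theorem eq_sum_apply_of_mem_gardingSubspace (P : CuspidalAutomorphicRepGL n K μ)
    (hτu : τ.IsUnitary) (hτi : τ.IsTopIrreducible) (hτ : τ.IsStronglyContinuous)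
    (hex : ∃ T ∈ archIntertwiners hcpt τ P.1, T ≠ 0)
    {k : ℕ} {S : Fin k → E →L[ℂ] (AdelicGroupData.gl n K).L2 μ}
    (hS : ∀ i, S i ∈ archIntertwinersLevel hcpt τ P.1 U₀)
    (hSon : ∀ i j, schurCoeff (μ := μ) (S i) (S j) = if i = j then 1 else 0)
    (hspan : ∀ T ∈ archIntertwinersLevel hcpt τ P.1 U₀, T ∈ Submodule.span ℂ (Set.range S))
    (hU₀o : IsOpen (U₀ : Set (GL (Fin n) (FiniteAdeleRing (𝓞 K) K))))
    (hU₀c : IsCompact (U₀ : Set (GL (Fin n) (FiniteAdeleRing (𝓞 K) K))))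
    {v : P.1.toSubmodule} (hv : v ∈ gardingSubspace P.1 U₀) :
    (∀ i, ContinuousLinearMap.adjoint (S i) (v : (AdelicGroupData.gl n K).L2 μ) ∈ archGardingSpace hcpt τ) ∧
      (v : (AdelicGroupData.gl n K).L2 μ) =
        ∑ i, S i (ContinuousLinearMap.adjoint (S i) (v : (AdelicGroupData.gl n K).L2 μ)) :=
  ⟨fun i => adjoint_mem_archGardingSpace_of_mem_gardingSubspace hτu hτ (hS i) hU₀o hU₀c hv,
    eq_sum_apply_adjoint_of_mem_levelPiece hcpt P hτu hτi hex hS hSon hspan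
      (coe_mem_levelPiece_of_mem_gardingSubspace hv)⟩

end AdjointTransfer


end Literature.NumberTheory.Automorphic
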